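import Mathlib.Algebra.Group.Action.Defs
import Mathlib.Data.Finset.Max
import Mathlib.Data.Fintype.Basic
import HarnessLib

/-!
# Venture HSemireg — LEX-LEADER SYMMETRY BREAKING IS SOUND (abstract kernel form)

Kernel form of premise NEW-3 of the symmetry-breaking legs of the door-(I) TRIPLE-PIN campaign
(cell pub-hsemireg, seat s0-2 gen 11, `step0/B/RESULT-B21.md` §3; code `stabsym.py` + `c9xlazy.py`
v10.11 `--lexstab`).  Those legs add, to a CNF `F` over piece variables that is invariant under a
finite group `G` of piece permutations (the set-wise stabiliser of the seed pieces inside encoder B's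
machine-checked symmetry group), the constraints «`x ≥_lex σ·x`» for the elements `σ` of a chosen
subset `S ⊆ G`, each possibly truncated to a prefix of the variable order.  The claim used there —
«`F` is satisfiable iff `F` together with all these constraints is» — is the classical soundness of
lex-leader symmetry-breaking predicates (Crawford–Ginsberg–Luks–Roy 1996; Aloul–Ramani–Markov–Sakallah,
IEEE TCAD 2003).  Here it is a tree theorem in the only generality the argument needs:

ABSTRACT SETTING.  `α` = assignments, linearly ordered (for a CNF: `Bool`-vectors under the
lexicographic order of a fixed variable order — any linear order will do); a finite group `G` acting on
`α`; a predicate `F : α → Prop` with `F a → F (g • a)` (syntactic symmetries of the formula).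

WHAT IS PROVED.
* `exists_orbit_max` : if `F` has a witness then it has a witness `a` with `g • a ≤ a` for EVERY
  `g : G` (the maximum of the orbit of any witness — the orbit is finite because `G` is).
* `sat_iff_sat_lexLeader` : for any `S : Set G`, `(∃ a, F a) ↔ ∃ a, F a ∧ ∀ g ∈ S, g • a ≤ a`.
* `sat_iff_sat_weaker` : the same for any family of side constraints `C a` IMPLIED by orbit-maximality
  (`(∀ g, g • a ≤ a) → C a`) — this covers the prefix-truncated chains (a lexicographic comparison of
  prefixes is implied by the comparison of the full vectors) and any sub-selection of group elements.

HONEST FRAMING.  Finite group actions and linear orders only; no CNF syntax, no SAT solver, no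
geometry; that the concrete permutations used by the legs ARE symmetries of the concrete clause
families is a separate, machine-checked premise (kit j228328 / j222029), not a theorem of this file;
nothing here bears on HC ∕ HC_CM ∕ HC_AV.
-/

namespace Summit.Ventures.HSemireg
namespace LexLeader

variable {G α : Type*} [Group G] [Fintype G] [MulAction G α] [LinearOrder α]

/-- If a `G`-invariant predicate on a linearly ordered `G`-set (`G` finite) has a witness, it has a
witness that dominates its whole orbit: `g • a ≤ a` for every `g`. (Take the maximum of the orbit.) -/
theorem exists_orbit_max (F : α → Prop) (hF : ∀ (g : G) (a : α), F a → F (g • a))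
    {a₀ : α} (h₀ : F a₀) : ∃ a, F a ∧ ∀ g : G, g • a ≤ a := by
  classical
  let S : Finset α := Finset.univ.image (fun g : G => g • a₀)
  have hne : S.Nonempty := ⟨(1 : G) • a₀, Finset.mem_image.mpr ⟨1, Finset.mem_univ _, rfl⟩⟩
  obtain ⟨g₀, -, hg₀⟩ := Finset.mem_image.mp (Finset.max'_mem S hne)
  refine ⟨S.max' hne, ?_, fun g => ?_⟩
  · rw [← hg₀]; exact hF g₀ a₀ h₀
  · apply Finset.le_max'
    rw [← hg₀, smul_smul]
    exact Finset.mem_image.mpr ⟨g * g₀, Finset.mem_univ _, rfl⟩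

/-- LEX-LEADER SOUNDNESS: adding the symmetry-breaking constraints `g • a ≤ a` for the elements of ANY
subset `S` of the symmetry group does not change satisfiability. -/
theorem sat_iff_sat_lexLeader (F : α → Prop) (hF : ∀ (g : G) (a : α), F a → F (g • a))
    (S : Set G) : (∃ a, F a) ↔ ∃ a, F a ∧ ∀ g ∈ S, g • a ≤ a := by
  constructor
  · rintro ⟨a₀, h₀⟩
    obtain ⟨a, ha, hmax⟩ := exists_orbit_max F hF h₀
    exact ⟨a, ha, fun g _ => hmax g⟩
  · rintro ⟨a, ha, -⟩
    exact ⟨a, ha⟩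

/-- The same for any side constraint `C` implied by orbit-maximality — e.g. prefix-truncated lex
chains, or chains for a sub-selection of group elements: `F` is satisfiable iff `F ∧ C` is. -/
theorem sat_iff_sat_weaker (F : α → Prop) (hF : ∀ (g : G) (a : α), F a → F (g • a))
    (C : α → Prop) (hC : ∀ a, (∀ g : G, g • a ≤ a) → C a) :
    (∃ a, F a) ↔ ∃ a, F a ∧ C a := by
  constructor
  · rintro ⟨a₀, h₀⟩
    obtain ⟨a, ha, hmax⟩ := exists_orbit_max F hF h₀
    exact ⟨a, ha, hC a hmax⟩
  · rintro ⟨a, ha, -⟩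
    exact ⟨a, ha⟩

/-- Contrapositive form used by a refutation: if `F ∧ C` has NO witness (e.g. the SAT solver's UNSAT
verdict / DRAT certificate for the CNF with the lex-leader clauses) then `F` has none. -/
theorem unsat_of_unsat_with_breaking (F : α → Prop) (hF : ∀ (g : G) (a : α), F a → F (g • a))
    (C : α → Prop) (hC : ∀ a, (∀ g : G, g • a ≤ a) → C a) (h : ¬ ∃ a, F a ∧ C a) :
    ¬ ∃ a, F a :=
  fun hex => h ((sat_iff_sat_weaker F hF C hC).mp hex)

end LexLeader
end Summit.Ventures.HSemireg
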